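import Summits.AtomisticToContinuum.BoseEinsteinCondensation.Theorems.BECGroundStateSOSPeriodicIRBoundDefs
import Summits.AtomisticToContinuum.BoseEinsteinCondensation.Theorems.BECGroundStateSOSPeriodicIRBoundWFDefs
import Literature.MathematicalPhysics.QuantumManyBody.TorusFockLayer
import Literature.MathematicalPhysics.QuantumManyBody.PeriodicConfigFourier
import Literature.MathematicalPhysics.QuantumManyBody.CoarseModeRayPOVMFormCore
import HarnessLib

/-! # Crux `PeriodicIRBound` (stmt-AtomisticToContinuum-3972), line `linear-ph-floor-wagner`, stub 5b `stub_wagnerFeynman` — Regularity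
B1–B2: `a_k Φ`, `a_k† Φ` of a core function are core functions (`C¹`, periodic, symmetric); derivative formulas for `a_k`. -/

/-!
# Regularity of `a(φ)Φ` and `a†(φ)Φ`: the core is stable under annihilation and creation

* `continuous_modeAn`, `continuous_modeCr` — continuity of `a(φ)Φ`, `a†(φ)Φ` for continuous data;
* `hasFDerivAt_modeAn`, `fderiv_modeAn_apply`, `fderiv_modeAn_single`, `contDiff_modeAn` —
  differentiation under the integral sign over the bounded cell: for a continuous mode `φ` and a
  `C¹` `(n+1)`-body `Φ`, `∂_v (a(φ)Φ)(Y) = √(n+1) ∫_cell conj φ(x) DΦ(x, Y)(0, v) dx`, and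
  `a(φ)Φ ∈ C¹`;
* `contDiff_modeCr` — `a†(φ)Φ ∈ C¹` for `C¹` data (finite sum of products);
* `isTorusPeriodic_modeAn`, `isTorusPeriodic_modeCr` — periodicity in every particle;
* `isSymm_modeAn`, `isSymm_modeCr` — Bose symmetry (for `a†`: dropping particle `j` of `X ∘ σ` is
  dropping particle `σ j` of `X` and relabelling the rest, `exists_removeNth_comp_perm`).

The analytic input is Mathlib's `hasFDerivAt_integral_of_dominated_of_fderiv_le` (one derivative
under the integral sign, the constant bound coming from continuity of `DΦ` on the compact
`closure(cell) × closedBall Y 1`) and the tree's `continuous_parametric_setIntegral_of_isBounded`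
(`CoarseModeRayPOVMFormCore.lean`).
-/

noncomputable section

open scoped BigOperators ENNReal ComplexConjugate
open Filter MeasureTheory

namespace Summit.AtomisticToContinuum.BoseEinsteinCondensation.Cruxes.PeriodicIRBound.LinearPhFloorWagner.WF

open Literature.MathematicalPhysics.QuantumManyBody.BoseGas

variable {M n : ℕ} {L : ℝ}

/-! ## Tuple bookkeeping: `vecCons`, `removeNth`, translations and relabellings -/

section Tuples

variable {m : ℕ}

/-- `(0, e_j ⊗ u) = e_{j+1} ⊗ u` in `(ℝ³)^{m+1}`. [folklore] -/
theorem vecCons_zero_single_eq (j : Fin m) (u : Space) :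
    (Matrix.vecCons (0 : Space) (Pi.single j u) : Config (m + 1)) = Pi.single j.succ u := by
  funext i
  refine Fin.cases ?_ (fun i => ?_) i
  · simp [Fin.succ_ne_zero]
  · simp [Pi.single_apply, Fin.succ_inj]

/-- Translating bath particle `j` of `(x, Y)` is translating particle `j + 1`:
`(x, Y + e_j ⊗ u) = (x, Y) + e_{j+1} ⊗ u`. [folklore] -/
theorem vecCons_add_single_eq (x : Space) (Y : Config m) (j : Fin m) (u : Space) :
    (Matrix.vecCons x (Y + Pi.single j u) : Config (m + 1)) =
      Matrix.vecCons x Y + Pi.single j.succ u := by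
  rw [← vecCons_zero_single_eq, Matrix.cons_add_cons, add_zero]

/-- Relabelling the bath: `(x, Y ∘ σ) = (x, Y) ∘ σ'` with `σ'` the lift of `σ` fixing `0`.
[folklore] -/
theorem vecCons_comp_perm (σ : Equiv.Perm (Fin m)) (x : Space) (Y : Config m) :
    (Matrix.vecCons x (Y ∘ σ) : Config (m + 1)) =
      Matrix.vecCons x Y ∘ Equiv.Perm.decomposeFin.symm (0, σ) := by
  funext i
  refine Fin.cases ?_ (fun j => ?_) i
  · simp [Equiv.Perm.decomposeFin_symm_apply_zero]
  · simp [Equiv.Perm.decomposeFin_symm_apply_succ, Equiv.swap_self]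

/-- Dropping a particle is additive. [folklore] -/
theorem removeNth_add (j : Fin (m + 1)) (X Z : Config (m + 1)) :
    j.removeNth (X + Z) = j.removeNth X + j.removeNth Z :=
  rfl

/-- Dropping particle `j` kills a translation of particle `j`. [folklore] -/
theorem removeNth_single_self (j : Fin (m + 1)) (u : Space) :
    j.removeNth (Pi.single j u : Config (m + 1)) = 0 := by
  funext i
  simp [Fin.removeNth, Fin.succAbove_ne]

/-- Dropping particle `j` turns a translation of particle `j.succAbove i` into one of particle `i`.
[folklore] -/
theorem removeNth_single_succAbove (j : Fin (m + 1)) (i : Fin m) (u : Space) :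
    j.removeNth (Pi.single (j.succAbove i) u : Config (m + 1)) = Pi.single i u := by
  funext i'
  simp [Fin.removeNth, Pi.single_apply]

/-- A permutation of `Fin (m+1)` fixing `0` restricts to a permutation `e` of `Fin m`:
`τ (i+1) = e(i) + 1` (cf. `exists_perm_bath` of `PeriodicBoseGasTagged.lean`). [folklore] -/
theorem exists_perm_succ_eq {τ : Equiv.Perm (Fin (m + 1))} (hτ : τ 0 = 0) :
    ∃ e : Equiv.Perm (Fin m), ∀ i : Fin m, τ i.succ = (e i).succ := by
  have h0 : ∀ j : Fin m, τ j.succ ≠ 0 := fun j h =>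
    Fin.succ_ne_zero j (τ.injective (h.trans hτ.symm))
  have h0' : ∀ j : Fin m, τ.symm j.succ ≠ 0 := fun j h =>
    Fin.succ_ne_zero j (by rw [← τ.apply_symm_apply j.succ, h, hτ])
  refine ⟨⟨fun j => (τ j.succ).pred (h0 j), fun j => (τ.symm j.succ).pred (h0' j),
    fun j => ?_, fun j => ?_⟩, fun j => ?_⟩
  · dsimp only
    rw [Fin.pred_eq_iff_eq_succ, Fin.succ_pred, Equiv.symm_apply_apply]
  · dsimp only
    rw [Fin.pred_eq_iff_eq_succ, Fin.succ_pred, Equiv.apply_symm_apply]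
  · simp only [Equiv.coe_fn_mk, Fin.succ_pred]

/-- **Dropping particle `j` after relabelling by `σ` is dropping particle `σ j` and relabelling the
rest**: `removeNth j (X ∘ σ) = (removeNth (σ j) X) ∘ e` for a permutation `e` of `Fin m` depending
only on `σ` and `j` (the restriction of `cycleRange (σ j) ∘ σ ∘ (cycleRange j)⁻¹`, which fixes `0`).
[folklore] -/
theorem exists_removeNth_comp_perm {α : Type*} (σ : Equiv.Perm (Fin (m + 1))) (j : Fin (m + 1)) :
    ∃ e : Equiv.Perm (Fin m), ∀ X : Fin (m + 1) → α,
      j.removeNth (X ∘ σ) = (σ j).removeNth X ∘ e := by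
  obtain ⟨e, he⟩ := exists_perm_succ_eq (m := m)
    (τ := (j.cycleRange.symm.trans σ).trans (σ j).cycleRange) (by simp)
  refine ⟨e, fun X => funext fun i => ?_⟩
  have hi : σ (j.succAbove i) = (σ j).succAbove (e i) := by
    rw [← Fin.cycleRange_symm_succ (σ j) (e i), ← he i]
    simp
  simp only [Fin.removeNth, Function.comp_apply, hi]

/-- Adjoining a first particle, `(x, Y) ↦ x :: Y = Matrix.vecCons x Y`, as a continuous linear map
`ℝ³ × (ℝ³)ⁿ →L[ℝ] (ℝ³)ⁿ⁺¹`. [folklore] -/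
def vecConsCLM (m : ℕ) : Space × Config m →L[ℝ] Config (m + 1) :=
  LinearMap.toContinuousLinearMap
    { toFun := fun q => Matrix.vecCons q.1 q.2
      map_add' := fun p q => (Matrix.cons_add_cons p.1 p.2 q.1 q.2).symm
      map_smul' := fun c p => (Matrix.smul_cons c p.1 p.2).symm }

/-- `vecConsCLM` is `Matrix.vecCons`. [folklore] -/
@[simp]
theorem vecConsCLM_apply (q : Space × Config m) : vecConsCLM m q = Matrix.vecCons q.1 q.2 :=
  rfl

/-- `(x, Y) ↦ Φ(x, Y)` is `C¹` on `ℝ³ × (ℝ³)ⁿ` when `Φ` is `C¹` on `(ℝ³)ⁿ⁺¹`. [folklore] -/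
theorem contDiff_comp_vecCons {k : WithTop ℕ∞} {Φ : Config (m + 1) → ℂ} (hΦ : ContDiff ℝ k Φ) :
    ContDiff ℝ k fun q : Space × Config m => Φ (Matrix.vecCons q.1 q.2) := by
  simpa only [Function.comp_def, vecConsCLM_apply] using hΦ.comp (vecConsCLM m).contDiff

/-- Chain rule through `vecConsCLM`: `D[Φ(x, Y)](q) = DΦ(x :: Y) ∘ vecConsCLM`. [folklore] -/
theorem fderiv_comp_vecCons {Φ : Config (m + 1) → ℂ} (hΦ : ContDiff ℝ 1 Φ) (q : Space × Config m) :
    fderiv ℝ (fun q : Space × Config m => Φ (Matrix.vecCons q.1 q.2)) q =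
      (fderiv ℝ Φ (Matrix.vecCons q.1 q.2)).comp (vecConsCLM m) :=
  ((hΦ.differentiable one_ne_zero _).hasFDerivAt.comp q (vecConsCLM m).hasFDerivAt).fderiv

/-- Dropping a particle is a smooth (linear) map. [folklore] -/
theorem contDiff_removeNth {k : WithTop ℕ∞} (j : Fin (m + 1)) :
    ContDiff ℝ k fun X : Config (m + 1) => j.removeNth X :=
  contDiff_pi.2 fun i => contDiff_apply ℝ Space (j.succAbove i)

end Tuples

/-! ## One derivative under the integral sign with a continuous weight -/

section Parametric

variable {Y : Type*} [NormedAddCommGroup Y] [NormedSpace ℝ Y] [FiniteDimensional ℝ Y]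
  [MeasurableSpace Y] [BorelSpace Y] {P : Type*} [NormedAddCommGroup P] [NormedSpace ℝ P]
  [FiniteDimensional ℝ P] {μ : Measure Y} [IsFiniteMeasureOnCompacts μ]

/-- **One derivative under the integral sign over a bounded set, with a continuous weight**: for a
continuous `g : Y → ℂ`, a jointly `C¹` kernel `G : Y × P → ℂ` and a bounded measurable `K ⊆ Y`,
`p ↦ ∫_K g(y) G(y, p) dμ(y)` has derivative `∫_K g(y) D G(y, p) ∘ (0, ·) dμ(y)` at every `p`
(Mathlib's `hasFDerivAt_integral_of_dominated_of_fderiv_le`, the constant bound coming from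
continuity of `g` and `DG` on the compact `closure K × closedBall p 1`). [folklore] -/
theorem hasFDerivAt_setIntegral_mul {K : Set Y} (hK : Bornology.IsBounded K)
    (hKm : MeasurableSet K) {g : Y → ℂ} (hg : Continuous g) {G : Y × P → ℂ}
    (hG : ContDiff ℝ 1 G) (p₀ : P) :
    HasFDerivAt (fun p : P => ∫ y in K, g y * G (y, p) ∂μ)
      (∫ y in K, g y • (fderiv ℝ G (y, p₀)).comp (ContinuousLinearMap.inr ℝ Y P) ∂μ) p₀ := by
  have hGc : Continuous G := hG.continuous
  have hDc : Continuous (fderiv ℝ G) := hG.continuous_fderiv one_ne_zero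
  set F' : P → Y → P →L[ℝ] ℂ :=
    fun p y => g y • (fderiv ℝ G (y, p)).comp (ContinuousLinearMap.inr ℝ Y P) with hF'
  have hF'c : Continuous (fun q : Y × P => F' q.2 q.1) := by
    simp only [hF']
    exact (hg.comp continuous_fst).smul
      ((hDc.comp (continuous_fst.prodMk continuous_snd)).clm_comp continuous_const)
  obtain ⟨C, hC⟩ : ∃ C, ∀ q ∈ closure K ×ˢ Metric.closedBall p₀ 1, ‖F' q.2 q.1‖ ≤ C := by
    have hK' : IsCompact (closure K ×ˢ Metric.closedBall p₀ (1 : ℝ)) :=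
      hK.isCompact_closure.prod (isCompact_closedBall p₀ 1)
    obtain ⟨C, hC⟩ := hK'.exists_bound_of_continuousOn hF'c.continuousOn
    exact ⟨C, hC⟩
  have hsl : ∀ p : P, Continuous fun y : Y => g y * G (y, p) := fun p =>
    hg.mul (hGc.comp (continuous_id.prodMk continuous_const))
  refine hasFDerivAt_integral_of_dominated_of_fderiv_le (μ := μ.restrict K)
    (F := fun p y => g y * G (y, p)) (F' := F') (bound := fun _ => C)
    (Metric.ball_mem_nhds p₀ one_pos) ?_ ?_ ?_ ?_ ?_ ?_
  · exact Eventually.of_forall fun p => (hsl p).aestronglyMeasurable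
  · exact integrableOn_of_continuous_of_isBounded hK (hsl p₀)
  · exact (hF'c.comp (continuous_id.prodMk continuous_const)).aestronglyMeasurable
  · rw [ae_restrict_iff' hKm]
    refine Eventually.of_forall fun y hy p hp => hC (y, p) ⟨subset_closure hy, ?_⟩
    exact Metric.mem_closedBall.2 (le_of_lt (Metric.mem_ball.1 hp))
  · have hμK : μ K ≠ ⊤ :=
      ((measure_mono subset_closure).trans_lt hK.isCompact_closure.measure_lt_top).ne
    exact integrableOn_const (hs := hμK)
  · exact Eventually.of_forall fun y p _ =>
      (Literature.Analysis.FunctionSpaces.hasFDerivAt_comp_prodMk_param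
        hG one_ne_zero y p).const_mul (g y)

/-- The directional derivatives of `p ↦ ∫_K g(y) G(y, p) dμ(y)`:
`∂_v = ∫_K g(y) DG(y, p)(0, v) dμ(y)`. [folklore] -/
theorem fderiv_setIntegral_mul_apply {K : Set Y} (hK : Bornology.IsBounded K)
    (hKm : MeasurableSet K) {g : Y → ℂ} (hg : Continuous g) {G : Y × P → ℂ}
    (hG : ContDiff ℝ 1 G) (p v : P) :
    fderiv ℝ (fun p : P => ∫ y in K, g y * G (y, p) ∂μ) p v =
      ∫ y in K, g y * fderiv ℝ G (y, p) ((0 : Y), v) ∂μ := by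
  rw [(hasFDerivAt_setIntegral_mul hK hKm hg hG p).fderiv]
  have hc : Continuous fun y : Y =>
      g y • (fderiv ℝ G (y, p)).comp (ContinuousLinearMap.inr ℝ Y P) :=
    hg.smul (((hG.continuous_fderiv one_ne_zero).comp
      (continuous_id.prodMk continuous_const)).clm_comp continuous_const)
  rw [ContinuousLinearMap.integral_apply (integrableOn_of_continuous_of_isBounded hK hc)]
  rfl

/-- **`C¹` dependence on the parameter** of `p ↦ ∫_K g(y) G(y, p) dμ(y)` for continuous `g`, jointly
`C¹` `G` and bounded measurable `K` (the derivative is again a parametric integral of a continuous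
integrand, `continuous_parametric_setIntegral_of_isBounded`). [folklore] -/
theorem contDiff_one_setIntegral_mul {K : Set Y} (hK : Bornology.IsBounded K)
    (hKm : MeasurableSet K) {g : Y → ℂ} (hg : Continuous g) {G : Y × P → ℂ}
    (hG : ContDiff ℝ 1 G) : ContDiff ℝ 1 fun p : P => ∫ y in K, g y * G (y, p) ∂μ := by
  have hd := fun p => hasFDerivAt_setIntegral_mul (μ := μ) hK hKm hg hG p
  rw [contDiff_one_iff_fderiv]
  refine ⟨fun p => (hd p).differentiableAt, ?_⟩
  have hfd : fderiv ℝ (fun p : P => ∫ y in K, g y * G (y, p) ∂μ) = fun p =>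
      ∫ y in K, g y • (fderiv ℝ G (y, p)).comp (ContinuousLinearMap.inr ℝ Y P) ∂μ :=
    funext fun p => (hd p).fderiv
  rw [hfd]
  have hc : Continuous fun q : Y × P =>
      g q.1 • (fderiv ℝ G q).comp (ContinuousLinearMap.inr ℝ Y P) :=
    (hg.comp continuous_fst).smul ((hG.continuous_fderiv one_ne_zero).clm_comp continuous_const)
  exact continuous_parametric_setIntegral_of_isBounded hK hKm hc

end Parametric

/-! ## `a(φ)Φ`: continuity, differentiation under the integral sign, periodicity, symmetry -/

/-- `aΦ = modeAn L φ Φ` is continuous for a continuous mode `φ` and a continuous `Φ` (parametric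
integral of a jointly continuous integrand over the bounded cell). [folklore] -/
theorem continuous_modeAn (L : ℝ) {φ : Space → ℂ} (hφ : Continuous φ) {n : ℕ}
    {Φ : Config (n + 1) → ℂ} (hΦ : Continuous Φ) : Continuous (modeAn L φ Φ) := by
  have hG : Continuous fun q : Space × Config n => conj (φ q.1) * Φ (Matrix.vecCons q.1 q.2) :=
    (Complex.continuous_conj.comp (hφ.comp continuous_fst)).mul
      (hΦ.comp (continuous_fst.matrixVecCons continuous_snd))
  change Continuous fun Y : Config n =>
    ((Real.sqrt (n + 1) : ℝ) : ℂ) * ∫ x in cell L, conj (φ x) * Φ (Matrix.vecCons x Y)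
  exact continuous_const.mul
    (continuous_parametric_setIntegral_of_isBounded (isBounded_cell L) (measurableSet_cell L) hG)

/-- **Differentiation under the integral sign for `a(φ)`**: for a continuous mode `φ` and a `C¹`
`(n+1)`-body `Φ`, `Y ↦ (a(φ)Φ)(Y) = √(n+1) ∫_cell conj φ(x) Φ(x, Y) dx` has derivative
`√(n+1) ∫_cell conj φ(x) DΦ(x, Y) ∘ (v ↦ (0, v)) dx` at every `Y`. [folklore] -/
theorem hasFDerivAt_modeAn (L : ℝ) {φ : Space → ℂ} (hφ : Continuous φ) {n : ℕ}
    {Φ : Config (n + 1) → ℂ} (hΦ : ContDiff ℝ 1 Φ) (Y : Config n) :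
    HasFDerivAt (modeAn L φ Φ)
      (((Real.sqrt (n + 1) : ℝ) : ℂ) • ∫ x in cell L, conj (φ x) •
        (fderiv ℝ Φ (Matrix.vecCons x Y)).comp
          ((vecConsCLM n).comp (ContinuousLinearMap.inr ℝ Space (Config n)))) Y := by
  have h := (hasFDerivAt_setIntegral_mul (μ := (volume : Measure Space)) (isBounded_cell L)
    (measurableSet_cell L) (Complex.continuous_conj.comp hφ : Continuous fun x => conj (φ x))
    (contDiff_comp_vecCons hΦ) Y).const_mul ((Real.sqrt (n + 1) : ℝ) : ℂ)
  simp only [fderiv_comp_vecCons hΦ, ContinuousLinearMap.comp_assoc] at h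
  exact h

/-- `a(φ)Φ` is differentiable for a continuous mode and a `C¹` `Φ`. [folklore] -/
theorem differentiable_modeAn (L : ℝ) {φ : Space → ℂ} (hφ : Continuous φ) {n : ℕ}
    {Φ : Config (n + 1) → ℂ} (hΦ : ContDiff ℝ 1 Φ) : Differentiable ℝ (modeAn L φ Φ) :=
  fun Y => (hasFDerivAt_modeAn L hφ hΦ Y).differentiableAt

/-- **The directional derivatives of `a(φ)Φ`**:
`∂_v (a(φ)Φ)(Y) = √(n+1) ∫_cell conj φ(x) DΦ(x, Y)(0, v) dx` (`(0, v) = Matrix.vecCons 0 v`).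
[folklore] -/
theorem fderiv_modeAn_apply (L : ℝ) {φ : Space → ℂ} (hφ : Continuous φ) {n : ℕ}
    {Φ : Config (n + 1) → ℂ} (hΦ : ContDiff ℝ 1 Φ) (Y v : Config n) :
    fderiv ℝ (modeAn L φ Φ) Y v = ((Real.sqrt (n + 1) : ℝ) : ℂ) *
      ∫ x in cell L, conj (φ x) * fderiv ℝ Φ (Matrix.vecCons x Y) (Matrix.vecCons 0 v) := by
  rw [(hasFDerivAt_modeAn L hφ hΦ Y).fderiv, smul_apply, smul_eq_mul]
  congr 1
  have hc : Continuous fun x : Space => conj (φ x) • (fderiv ℝ Φ (Matrix.vecCons x Y)).comp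
      ((vecConsCLM n).comp (ContinuousLinearMap.inr ℝ Space (Config n))) :=
    (Complex.continuous_conj.comp hφ).smul (((hΦ.continuous_fderiv one_ne_zero).comp
      (continuous_id.matrixVecCons continuous_const)).clm_comp continuous_const)
  rw [ContinuousLinearMap.integral_apply
    (integrableOn_of_continuous_of_isBounded (isBounded_cell L) hc)]
  rfl

/-- The partial derivatives of `a(φ)Φ` along particle `j`, axis direction `u`:
`∂_{j,u} (a(φ)Φ)(Y) = √(n+1) ∫_cell conj φ(x) ∂_{j+1,u}Φ(x, Y) dx`. [folklore] -/
theorem fderiv_modeAn_single (L : ℝ) {φ : Space → ℂ} (hφ : Continuous φ) {n : ℕ}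
    {Φ : Config (n + 1) → ℂ} (hΦ : ContDiff ℝ 1 Φ) (Y : Config n) (j : Fin n) (u : Space) :
    fderiv ℝ (modeAn L φ Φ) Y (Pi.single j u) = ((Real.sqrt (n + 1) : ℝ) : ℂ) *
      ∫ x in cell L, conj (φ x) * fderiv ℝ Φ (Matrix.vecCons x Y) (Pi.single j.succ u) := by
  rw [fderiv_modeAn_apply L hφ hΦ, vecCons_zero_single_eq]

/-- **`a(φ)Φ ∈ C¹`** for a continuous mode `φ` and `Φ ∈ C¹` (one derivative under the integral sign
plus continuity of the derivative, a parametric integral of a continuous integrand). [folklore] -/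
theorem contDiff_modeAn (L : ℝ) {φ : Space → ℂ} (hφ : Continuous φ) {n : ℕ}
    {Φ : Config (n + 1) → ℂ} (hΦ : ContDiff ℝ 1 Φ) : ContDiff ℝ 1 (modeAn L φ Φ) := by
  have h := contDiff_one_setIntegral_mul (μ := (volume : Measure Space)) (isBounded_cell L)
    (measurableSet_cell L) (Complex.continuous_conj.comp hφ : Continuous fun x => conj (φ x))
    (contDiff_comp_vecCons hΦ)
  change ContDiff ℝ 1 fun Y : Config n =>
    ((Real.sqrt (n + 1) : ℝ) : ℂ) * ∫ x in cell L, conj (φ x) * Φ (Matrix.vecCons x Y)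
  exact contDiff_const.mul h

/-- **`a(φ)Φ` is periodic in every particle** when `Φ` is (translating bath particle `j` of `(x, Y)`
is translating particle `j+1`). [folklore] -/
theorem isTorusPeriodic_modeAn (L : ℝ) (φ : Space → ℂ) {n : ℕ} {Φ : Config (n + 1) → ℂ}
    (hΦ : IsTorusPeriodic L Φ) : IsTorusPeriodic L (modeAn L φ Φ) := by
  intro Y i c
  have h := fun x : Space => hΦ (Matrix.vecCons x Y) i.succ c
  simp only [modeAn_apply, vecCons_add_single_eq, h]

/-- **`a(φ)Φ` is Bose-symmetric** when `Φ` is (relabelling the bath is a relabelling of all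
particles fixing the contracted one). [folklore] -/
theorem isSymm_modeAn {φ : Space → ℂ} {n : ℕ} {Φ : Config (n + 1) → ℂ} (hΦ : IsSymm Φ) :
    IsSymm (modeAn L φ Φ) := by
  intro σ Y
  have h := fun x : Space => hΦ (Equiv.Perm.decomposeFin.symm (0, σ)) (Matrix.vecCons x Y)
  simp only [modeAn_apply, vecCons_comp_perm, h]

/-- B1: `aΦ` is a core function when `Φ` is (parametric integral of a `C¹` function over the bounded cell). -/
theorem isCore_modeAn (hL : 0 < L) (k : Fin 3 → ℤ) {Φ : Config (n + 1) → ℂ} (hΦ : IsCore L Φ) :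
    IsCore L (modeAn L (planeWaveMode L k) Φ) := by
  have _ := hL
  exact ⟨contDiff_modeAn L (continuous_planeWaveMode L k) hΦ.contDiff,
    isTorusPeriodic_modeAn L _ hΦ.periodic, isSymm_modeAn hΦ.symm⟩

/-! ## `a†(φ)Φ`: continuity, `C¹`, periodicity, symmetry -/

/-- `a†Φ = modeCr φ Φ` is continuous for continuous `φ`, `Φ` (a finite sum of products of continuous
functions). [folklore] -/
theorem continuous_modeCr {φ : Space → ℂ} (hφ : Continuous φ) {n : ℕ} {Φ : Config n → ℂ}
    (hΦ : Continuous Φ) : Continuous (modeCr φ Φ) := by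
  change Continuous fun X : Config (n + 1) =>
    ((Real.sqrt (n + 1) : ℝ) : ℂ)⁻¹ * ∑ j : Fin (n + 1), φ (X j) * Φ (j.removeNth X)
  exact continuous_const.mul (continuous_finsetSum _ fun j _ =>
    ((hφ.comp (continuous_apply j)).mul (hΦ.comp (continuous_removeNth j))))

/-- **`a†(φ)Φ ∈ C¹`** for `φ, Φ ∈ C¹` (finite sum of products; dropping a particle is linear).
[folklore] -/
theorem contDiff_modeCr {φ : Space → ℂ} (hφ : ContDiff ℝ 1 φ) {n : ℕ} {Φ : Config n → ℂ}
    (hΦ : ContDiff ℝ 1 Φ) : ContDiff ℝ 1 (modeCr φ Φ) := by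
  change ContDiff ℝ 1 fun X : Config (n + 1) =>
    ((Real.sqrt (n + 1) : ℝ) : ℂ)⁻¹ * ∑ j : Fin (n + 1), φ (X j) * Φ (j.removeNth X)
  exact contDiff_const.mul (ContDiff.sum fun j _ =>
    (hφ.comp (contDiff_apply ℝ Space j)).mul (hΦ.comp (contDiff_removeNth j)))

/-- **`a†(φ)Φ` is periodic in every particle** when `φ` is `Lℤ³`-periodic and `Φ` is periodic in
every particle (the term `j = i` uses the periodicity of `φ`, the terms `j ≠ i` that of `Φ`).
[folklore] -/
theorem isTorusPeriodic_modeCr {φ : Space → ℂ}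
    (hφ : ∀ (x : Space) (c : Fin 3), φ (x + EuclideanSpace.single c L) = φ x) {n : ℕ}
    {Φ : Config n → ℂ} (hΦ : IsTorusPeriodic L Φ) : IsTorusPeriodic L (modeCr φ Φ) := by
  intro X i c
  rw [modeCr_apply, modeCr_apply]
  congr 1
  refine Finset.sum_congr rfl fun j _ => ?_
  rcases eq_or_ne i j with rfl | hij
  · rw [Pi.add_apply, Pi.single_eq_same, hφ, removeNth_add, removeNth_single_self, add_zero]
  · obtain ⟨i', rfl⟩ := Fin.exists_succAbove_eq hij
    rw [Pi.add_apply, Pi.single_eq_of_ne (Fin.succAbove_ne j i').symm, add_zero, removeNth_add,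
      removeNth_single_succAbove, hΦ]

/-- **`a†(φ)Φ` is Bose-symmetric** when `Φ` is: `Σ_j φ(x_{σ j}) Φ((X ∘ σ) without j)` is the sum
`Σ_j φ(x_j) Φ(X without j)` reindexed by `σ`, because dropping particle `j` of `X ∘ σ` is dropping
particle `σ j` of `X` up to a relabelling (`exists_removeNth_comp_perm`). [folklore] -/
theorem isSymm_modeCr {φ : Space → ℂ} {n : ℕ} {Φ : Config n → ℂ} (hΦ : IsSymm Φ) :
    IsSymm (modeCr φ Φ) := by
  intro σ X
  rw [modeCr_apply, modeCr_apply]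
  congr 1
  have h : ∀ j : Fin (n + 1), Φ (j.removeNth (X ∘ σ)) = Φ ((σ j).removeNth X) := fun j => by
    obtain ⟨e, he⟩ := exists_removeNth_comp_perm (α := Space) σ j
    rw [he X, hΦ]
  simp only [h, Function.comp_apply]
  exact Equiv.sum_comp σ (fun j => φ (X j) * Φ (j.removeNth X))

/-- B2: `a†Φ` is a core function when `Φ` is. -/
theorem isCore_modeCr (hL : 0 < L) (k : Fin 3 → ℤ) {Φ : Config n → ℂ} (hΦ : IsCore L Φ) :
    IsCore L (modeCr (planeWaveMode L k) Φ) :=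
  ⟨contDiff_modeCr ((contDiff_planeWaveMode L k).of_le (mod_cast le_top)) hΦ.contDiff,
    isTorusPeriodic_modeCr (fun x c => planeWaveMode_periodic hL.ne' k x c) hΦ.periodic,
    isSymm_modeCr hΦ.symm⟩

end Summit.AtomisticToContinuum.BoseEinsteinCondensation.Cruxes.PeriodicIRBound.LinearPhFloorWagner.WF

end

namespace Summit.AtomisticToContinuum.BoseEinsteinCondensation.Cruxes.PeriodicIRBound.LinearPhFloorWagner

/-- The registered sub-goal `stub_wfRegularity` of the crux ledger: this file's headline lemma `WF.isCore_modeAn`. -/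
theorem stub_wfRegularity : WF.Pkg.Regularity :=
  @WF.isCore_modeAn

end Summit.AtomisticToContinuum.BoseEinsteinCondensation.Cruxes.PeriodicIRBound.LinearPhFloorWagner
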